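import Literature.Analysis.FluidPDE.TorusClassicalNSGlobalLimit
import Literature.Analysis.FunctionSpaces.TorusGevreyCompactness
import Literature.Analysis.FunctionSpaces.TorusSobolevSpace
import HarnessLib

/-!
# The set of states of global bounded-enstrophy, uniformly-Gevrey classical Navier–Stokes solutions
# on `T³` is compact in the energy space

Analysis/FluidPDE proof file (theorems only; no definitions, no named facts). Fix `ν > 0`, a steady force
`F`, an enstrophy level `R` and Gevrey constants `σ > 0`, `C`. A state `x ∈ H = Torus.energySpace d` is a
BOUNDED GEVREY TRAJECTORY STATE when some classical solution `(u, p)` of NS_ν(F) on `[0, ∞) × T^d` with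
mean-zero slices, `‖∇u(t)‖₂² ≤ R` and `∑_{k∈S} e^{2σ|k|} ‖û(t)(k)‖² ≤ C` for all `t ≥ 0` has `x =ᵐ u(0)`.
No definition is introduced: every statement takes a set `K₁ ⊆ H` together with this membership
characterisation `hK₁` as a hypothesis (the summit-side user instantiates it with a set-builder). Contents:

* bookkeeping in `H`: `Torus.exists_energySpace_coe_ae_eq` (an honest field has a state),
  `Torus.energySpace_norm_sq_eq`, `Torus.energySpace_norm_sub_sq_eq` (norms through representatives),
  `Torus.IsClassicalNSSolutionOn.slice_eq_of_coe_ae_eq` / `….eq_of_coe_ae_eq` (global classical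
  trajectories issued from the same state coincide: forward uniqueness `velocity_unique_of_mem`),
  `Torus.IsClassicalNSSolutionOn.shift_Ici` (time shifts);
* `Torus.trajectorySet_mem_of_shift` — `K₁` contains the forward orbit of each of its trajectories;
  `Torus.trajectorySet_mem_of_one_le` — states at times `≥ 1` of global mean-zero solutions with
  `‖∇u‖₂² ≤ R` lie in `K₁` as soon as `(σ, C)` are Gevrey-smoothing constants for the level `R` and the lapse
  `1` (Foias–Temam; the tree's `Torus.IsClassicalNSSolutionOn.gevrey_of_gradNormSq_le`, taken as the
  hypothesis `hE9` so that no force hypothesis is needed here);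
* `Torus.isCompact_trajectorySet` — **`K₁` is compact in `H`** (`card d = 3`): a sequence of states has
  data `uₙ(0)` with a uniform Gevrey bound, so a subsequence converges in `H¹` to a smooth solenoidal
  mean-zero `w` (`Torus.exists_smooth_limit_of_gevrey_bound`, E10); the corresponding solutions converge to a
  GLOBAL classical solution through `w` keeping all the bounds
  (`Torus.exists_global_classicalNS_of_tendsto_of_bounds`); its state is the limit of the subsequence.

This is the compactness of bounded sets of strong trajectories behind the global attractor / enlarged
phase constructions (Robinson–Rodrigo–Sadowski 2016, Thm 6.10 with Thm 7.5; Constantin–Foias 1988 Ch. 10,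
14). Deliberately NOT here: continuity of the solution map and of the enstrophy on `K₁`
(`TorusNSBoundedTrajectoryContinuity`), anything about semiflows.

## References

* J. C. Robinson, J. L. Rodrigo, W. Sadowski, *The Three-Dimensional Navier–Stokes Equations*, CUP 2016,
  Thm 6.10, Thm 7.5, §8.1. [RobinsonRodrigoSadowskiCUP2016]
* C. Foias, R. Temam, *Gevrey class regularity for the solutions of the Navier–Stokes equations*,
  J. Funct. Anal. 87 (1989) 359–369, Thm 1.1. [FoiasTemam1989]
-/

noncomputable section

open MeasureTheory Set Function Filter UnitAddTorus
open scoped ContDiff InnerProductSpace Topology NNReal ENNReal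

namespace Literature.Analysis.FluidPDE

open Literature.Analysis.FunctionSpaces

variable {d : Type*} [Fintype d] [DecidableEq d]

/-! ### States in the energy space and their representatives -/

section States

/-- An honest (smooth, divergence-free, mean-zero) field has a state in `H`: some `x ∈ Torus.energySpace d`
is represented by it (`Torus.smoothSolenoidal_subset_energySpace`). [folklore] -/
theorem Torus.exists_energySpace_coe_ae_eq {w : UnitAddTorus d → EuclideanSpace ℝ d} (hw : Torus.IsSmooth w)
    (hdiv : Torus.IsDivFree w) (hmean : Torus.HasZeroMean w) :
    ∃ x : Torus.energySpace d,
      ((x : Lp (EuclideanSpace ℝ d) 2 (volume : Measure (UnitAddTorus d))) : UnitAddTorus d → EuclideanSpace ℝ d)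
        =ᵐ[volume] w :=
  ⟨⟨(hw.memLp 2).toLp w, Torus.smoothSolenoidal_subset_energySpace ⟨w, hw, hdiv, hmean, (hw.memLp 2).coeFn_toLp⟩⟩,
    (hw.memLp 2).coeFn_toLp⟩

/-- `‖x‖² = ∫ ‖v‖²` for a state `x ∈ H` represented by `v`. [folklore] -/
theorem Torus.energySpace_norm_sq_eq {x : Torus.energySpace d} {v : UnitAddTorus d → EuclideanSpace ℝ d}
    (h : ((x : Lp (EuclideanSpace ℝ d) 2 (volume : Measure (UnitAddTorus d))) : UnitAddTorus d → EuclideanSpace ℝ d)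
      =ᵐ[volume] v) :
    ‖x‖ ^ 2 = ∫ y, ‖v y‖ ^ 2 := by
  have h1 : ‖x‖ = ‖(x : Lp (EuclideanSpace ℝ d) 2 (volume : Measure (UnitAddTorus d)))‖ := rfl
  rw [h1, ← real_inner_self_eq_norm_sq, MeasureTheory.L2.inner_def]
  refine integral_congr_ae (h.mono fun y hy => ?_)
  show ⟪((x : Lp (EuclideanSpace ℝ d) 2 (volume : Measure (UnitAddTorus d))) : UnitAddTorus d → EuclideanSpace ℝ d) y,
    ((x : Lp (EuclideanSpace ℝ d) 2 (volume : Measure (UnitAddTorus d))) : UnitAddTorus d → EuclideanSpace ℝ d) y⟫_ℝ =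
      ‖v y‖ ^ 2
  rw [hy, real_inner_self_eq_norm_sq]

/-- `‖x − y‖² = ∫ ‖v − w‖²` for states `x, y ∈ H` represented by `v`, `w`. [folklore] -/
theorem Torus.energySpace_norm_sub_sq_eq {x y : Torus.energySpace d} {v w : UnitAddTorus d → EuclideanSpace ℝ d}
    (hx : ((x : Lp (EuclideanSpace ℝ d) 2 (volume : Measure (UnitAddTorus d))) : UnitAddTorus d → EuclideanSpace ℝ d)
      =ᵐ[volume] v)
    (hy : ((y : Lp (EuclideanSpace ℝ d) 2 (volume : Measure (UnitAddTorus d))) : UnitAddTorus d → EuclideanSpace ℝ d)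
      =ᵐ[volume] w) :
    ‖x - y‖ ^ 2 = ∫ z, ‖v z - w z‖ ^ 2 := by
  have h1 : (((x - y : Torus.energySpace d) : Lp (EuclideanSpace ℝ d) 2 (volume : Measure (UnitAddTorus d))) :
      UnitAddTorus d → EuclideanSpace ℝ d) =ᵐ[volume] fun z =>
        ((x : Lp (EuclideanSpace ℝ d) 2 (volume : Measure (UnitAddTorus d))) : UnitAddTorus d → EuclideanSpace ℝ d) z -
        ((y : Lp (EuclideanSpace ℝ d) 2 (volume : Measure (UnitAddTorus d))) : UnitAddTorus d → EuclideanSpace ℝ d) z := by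
    rw [Submodule.coe_sub]
    exact Lp.coeFn_sub _ _
  refine Torus.energySpace_norm_sq_eq ?_
  filter_upwards [h1, hx, hy] with z hz h2 h3
  rw [hz, h2, h3]

/-- Slices (at times `≥ 0`) of classical solutions on `[0, ∞) × T^d` representing the same state of `H`
are equal (smooth, hence continuous, and a.e. equal; Mathlib `Continuous.ae_eq_iff_eq`). [folklore] -/
theorem _root_.Literature.Analysis.FunctionSpaces.Torus.IsClassicalNSSolutionOn.slice_eq_of_coe_ae_eq {ν : ℝ}
    {f u₁ u₂ : ℝ → UnitAddTorus d → EuclideanSpace ℝ d} {p₁ p₂ : ℝ → UnitAddTorus d → ℝ}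
    (h₁ : Torus.IsClassicalNSSolutionOn (Ici 0) ν f u₁ p₁) (h₂ : Torus.IsClassicalNSSolutionOn (Ici 0) ν f u₂ p₂)
    {x : Torus.energySpace d} {t₁ t₂ : ℝ} (ht₁ : 0 ≤ t₁) (ht₂ : 0 ≤ t₂)
    (hx₁ : ((x : Lp (EuclideanSpace ℝ d) 2 (volume : Measure (UnitAddTorus d))) : UnitAddTorus d → EuclideanSpace ℝ d)
      =ᵐ[volume] u₁ t₁)
    (hx₂ : ((x : Lp (EuclideanSpace ℝ d) 2 (volume : Measure (UnitAddTorus d))) : UnitAddTorus d → EuclideanSpace ℝ d)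
      =ᵐ[volume] u₂ t₂) :
    u₁ t₁ = u₂ t₂ :=
  (Continuous.ae_eq_iff_eq volume (h₁.smooth_velocity.isSmooth_slice (mem_Ici.2 ht₁)).continuous
    (h₂.smooth_velocity.isSmooth_slice (mem_Ici.2 ht₂)).continuous).1 (hx₁.symm.trans hx₂)

/-- **Global classical trajectories issued from the same state coincide**: two classical solutions of
NS_ν(f), `ν ≥ 0`, on `[0, ∞) × T^d` whose initial slices represent the same `x ∈ H` agree at every `t ≥ 0`
(forward uniqueness `velocity_unique_of_mem`). [cite: RobinsonRodrigoSadowskiCUP2016, Thm 6.10] -/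
theorem _root_.Literature.Analysis.FunctionSpaces.Torus.IsClassicalNSSolutionOn.eq_of_coe_ae_eq {ν : ℝ} (hν : 0 ≤ ν)
    {f u₁ u₂ : ℝ → UnitAddTorus d → EuclideanSpace ℝ d} {p₁ p₂ : ℝ → UnitAddTorus d → ℝ}
    (h₁ : Torus.IsClassicalNSSolutionOn (Ici 0) ν f u₁ p₁) (h₂ : Torus.IsClassicalNSSolutionOn (Ici 0) ν f u₂ p₂)
    {x : Torus.energySpace d}
    (hx₁ : ((x : Lp (EuclideanSpace ℝ d) 2 (volume : Measure (UnitAddTorus d))) : UnitAddTorus d → EuclideanSpace ℝ d)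
      =ᵐ[volume] u₁ 0)
    (hx₂ : ((x : Lp (EuclideanSpace ℝ d) 2 (volume : Measure (UnitAddTorus d))) : UnitAddTorus d → EuclideanSpace ℝ d)
      =ᵐ[volume] u₂ 0) {t : ℝ} (ht : 0 ≤ t) :
    u₁ t = u₂ t :=
  h₁.velocity_unique_of_mem hν (convex_Ici 0) h₂ (mem_Ici.2 le_rfl)
    (h₁.slice_eq_of_coe_ae_eq h₂ le_rfl le_rfl hx₁ hx₂) (mem_Ici.2 ht) ht

/-- Time shift of a global classical solution with a steady force: `(u, p)(· + s)` is classical on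
`[0, ∞)` for `s ≥ 0` (`Torus.IsClassicalNSSolutionOn.comp_add_const`). [folklore] -/
theorem _root_.Literature.Analysis.FunctionSpaces.Torus.IsClassicalNSSolutionOn.shift_Ici {ν : ℝ}
    {F : UnitAddTorus d → EuclideanSpace ℝ d} {u : ℝ → UnitAddTorus d → EuclideanSpace ℝ d} {p : ℝ → UnitAddTorus d → ℝ}
    (h : Torus.IsClassicalNSSolutionOn (Ici 0) ν (fun _ => F) u p) {s : ℝ} (hs : 0 ≤ s) :
    Torus.IsClassicalNSSolutionOn (Ici 0) ν (fun _ => F) (fun t => u (t + s)) (fun t => p (t + s)) :=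
  (h.comp_add_const s).mono (fun _ ht => mem_Ici.2 (add_nonneg (mem_Ici.1 ht) hs)) (uniqueDiffOn_Ici 0)

end States

/-! ### The set of bounded Gevrey trajectory states: invariance and compactness -/

section TrajectorySet

variable {ν R σ C : ℝ} {F : UnitAddTorus d → EuclideanSpace ℝ d} {K₁ : Set (Torus.energySpace d)}

/-- **`K₁` contains the forward orbit of each of its trajectories**: if `(u, p)` is a global classical
mean-zero solution of NS_ν(F) with `‖∇u(t)‖₂² ≤ R` and the Gevrey bound `(σ, C)` for all `t ≥ 0`, then every
state represented by a slice `u(s)`, `s ≥ 0`, belongs to `K₁` (witness: the shifted solution). [folklore] -/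
theorem Torus.trajectorySet_mem_of_shift
    (hK₁ : ∀ x : Torus.energySpace d, x ∈ K₁ ↔
      ∃ (u : ℝ → UnitAddTorus d → EuclideanSpace ℝ d) (p : ℝ → UnitAddTorus d → ℝ),
        Torus.IsClassicalNSSolutionOn (Ici 0) ν (fun _ => F) u p ∧ (∀ t : ℝ, 0 ≤ t → Torus.HasZeroMean (u t)) ∧
        (∀ t : ℝ, 0 ≤ t → Torus.gradNormSq (u t) ≤ R) ∧
        (∀ t : ℝ, 0 ≤ t → ∀ S : Finset (d → ℤ), ∑ k ∈ S, Real.exp (2 * σ * Real.sqrt (Torus.freqNormSq k)) *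
          ‖mFourierCoeff (EuclideanSpace.complexify ∘ u t) k‖ ^ 2 ≤ C) ∧
        ((x : Lp (EuclideanSpace ℝ d) 2 (volume : Measure (UnitAddTorus d))) : UnitAddTorus d → EuclideanSpace ℝ d)
          =ᵐ[volume] u 0)
    {u : ℝ → UnitAddTorus d → EuclideanSpace ℝ d} {p : ℝ → UnitAddTorus d → ℝ}
    (hsol : Torus.IsClassicalNSSolutionOn (Ici 0) ν (fun _ => F) u p) (hmean : ∀ t : ℝ, 0 ≤ t → Torus.HasZeroMean (u t))
    (hR : ∀ t : ℝ, 0 ≤ t → Torus.gradNormSq (u t) ≤ R)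
    (hG : ∀ t : ℝ, 0 ≤ t → ∀ S : Finset (d → ℤ), ∑ k ∈ S, Real.exp (2 * σ * Real.sqrt (Torus.freqNormSq k)) *
      ‖mFourierCoeff (EuclideanSpace.complexify ∘ u t) k‖ ^ 2 ≤ C)
    {s : ℝ} (hs : 0 ≤ s) {y : Torus.energySpace d}
    (hy : ((y : Lp (EuclideanSpace ℝ d) 2 (volume : Measure (UnitAddTorus d))) : UnitAddTorus d → EuclideanSpace ℝ d)
      =ᵐ[volume] u s) :
    y ∈ K₁ :=
  (hK₁ y).2 ⟨fun t => u (t + s), fun t => p (t + s), hsol.shift_Ici hs, fun t ht => hmean (t + s) (add_nonneg ht hs),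
    fun t ht => hR (t + s) (add_nonneg ht hs), fun t ht S => hG (t + s) (add_nonneg ht hs) S,
    by simpa only [zero_add] using hy⟩

/-- **States at times `≥ 1` of bounded-enstrophy global solutions lie in `K₁`.** Suppose `(σ, C)` are such
that every classical mean-zero solution of NS_ν(F) on a window `[a, a + 1]` with `‖∇u‖₂² ≤ R` there satisfies
`∑_{k∈S} e^{2σ|k|} ‖û(a + 1)(k)‖² ≤ C` (hypothesis `hE9`: the Gevrey smoothing theorem
`Torus.IsClassicalNSSolutionOn.gevrey_of_gradNormSq_le` with lapse `1`). Then for every global classical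
mean-zero solution `(u, p)` with `‖∇u(t)‖₂² ≤ R` for all `t ≥ 0`, every state represented by `u(s)`, `s ≥ 1`,
belongs to `K₁`: the shifted solution `u(· + s)` is Gevrey-bounded at every `t ≥ 0` by `hE9` on
`[t + s − 1, t + s] ⊆ [0, ∞)`. [cite: FoiasTemam1989, Thm 1.1] -/
theorem Torus.trajectorySet_mem_of_one_le
    (hK₁ : ∀ x : Torus.energySpace d, x ∈ K₁ ↔
      ∃ (u : ℝ → UnitAddTorus d → EuclideanSpace ℝ d) (p : ℝ → UnitAddTorus d → ℝ),
        Torus.IsClassicalNSSolutionOn (Ici 0) ν (fun _ => F) u p ∧ (∀ t : ℝ, 0 ≤ t → Torus.HasZeroMean (u t)) ∧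
        (∀ t : ℝ, 0 ≤ t → Torus.gradNormSq (u t) ≤ R) ∧
        (∀ t : ℝ, 0 ≤ t → ∀ S : Finset (d → ℤ), ∑ k ∈ S, Real.exp (2 * σ * Real.sqrt (Torus.freqNormSq k)) *
          ‖mFourierCoeff (EuclideanSpace.complexify ∘ u t) k‖ ^ 2 ≤ C) ∧
        ((x : Lp (EuclideanSpace ℝ d) 2 (volume : Measure (UnitAddTorus d))) : UnitAddTorus d → EuclideanSpace ℝ d)
          =ᵐ[volume] u 0)
    (hE9 : ∀ {a : ℝ} {u : ℝ → UnitAddTorus d → EuclideanSpace ℝ d} {p : ℝ → UnitAddTorus d → ℝ},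
      Torus.IsClassicalNSSolutionOn (Icc a (a + 1)) ν (fun _ => F) u p → (∀ t ∈ Icc a (a + 1), Torus.HasZeroMean (u t)) →
      (∀ t ∈ Icc a (a + 1), Torus.gradNormSq (u t) ≤ R) →
      ∀ S : Finset (d → ℤ), ∑ k ∈ S, Real.exp (2 * σ * Real.sqrt (Torus.freqNormSq k)) *
        ‖mFourierCoeff (EuclideanSpace.complexify ∘ u (a + 1)) k‖ ^ 2 ≤ C)
    {u : ℝ → UnitAddTorus d → EuclideanSpace ℝ d} {p : ℝ → UnitAddTorus d → ℝ}
    (hsol : Torus.IsClassicalNSSolutionOn (Ici 0) ν (fun _ => F) u p) (hmean : ∀ t : ℝ, 0 ≤ t → Torus.HasZeroMean (u t))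
    (hR : ∀ t : ℝ, 0 ≤ t → Torus.gradNormSq (u t) ≤ R) {s : ℝ} (hs : 1 ≤ s) {y : Torus.energySpace d}
    (hy : ((y : Lp (EuclideanSpace ℝ d) 2 (volume : Measure (UnitAddTorus d))) : UnitAddTorus d → EuclideanSpace ℝ d)
      =ᵐ[volume] u s) :
    y ∈ K₁ := by
  have hs0 : 0 ≤ s := zero_le_one.trans hs
  refine (hK₁ y).2 ⟨fun t => u (t + s), fun t => p (t + s), hsol.shift_Ici hs0,
    fun t ht => hmean (t + s) (add_nonneg ht hs0), fun t ht => hR (t + s) (add_nonneg ht hs0),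
    fun t ht S => ?_, by simpa only [zero_add] using hy⟩
  have ha : 0 ≤ t + s - 1 := by linarith
  have hsub : Icc (t + s - 1) (t + s - 1 + 1) ⊆ Ici 0 := fun τ hτ => mem_Ici.2 (ha.trans hτ.1)
  have h := hE9 (hsol.mono hsub (uniqueDiffOn_Icc (by linarith))) (fun τ hτ => hmean τ (ha.trans hτ.1))
    (fun τ hτ => hR τ (ha.trans hτ.1)) S
  rw [sub_add_cancel] at h
  exact h

/-- **The set of bounded Gevrey trajectory states is compact in `H`** (`card d = 3`, `ν > 0`, `σ > 0`).
Given a sequence in `K₁` with trajectories `(uₙ, pₙ)`, the data `uₙ(0)` are smooth, solenoidal, mean-zero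
and uniformly Gevrey, so a subsequence converges in `H¹` to such a field `w` with the same Gevrey bound
(`Torus.exists_smooth_limit_of_gevrey_bound`); along it the solutions converge, at every `t ≥ 0`, to a GLOBAL
classical solution `(v, q)` through `w` with mean-zero slices, `‖∇v(t)‖₂² ≤ R` and the Gevrey bound
(`Torus.exists_global_classicalNS_of_tendsto_of_bounds`); the state of `w` lies in `K₁` and is the limit of
the subsequence in `H` (`‖xₙ − x‖² = ∫ ‖uₙ(0) − w‖²`). Sequential compactness is compactness in the metric
space `H`. [cite: RobinsonRodrigoSadowskiCUP2016, Thm 6.10 with Thm 7.5] -/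
theorem Torus.isCompact_trajectorySet (hd : Fintype.card d = 3) (hν : 0 < ν) (hσ : 0 < σ)
    (hK₁ : ∀ x : Torus.energySpace d, x ∈ K₁ ↔
      ∃ (u : ℝ → UnitAddTorus d → EuclideanSpace ℝ d) (p : ℝ → UnitAddTorus d → ℝ),
        Torus.IsClassicalNSSolutionOn (Ici 0) ν (fun _ => F) u p ∧ (∀ t : ℝ, 0 ≤ t → Torus.HasZeroMean (u t)) ∧
        (∀ t : ℝ, 0 ≤ t → Torus.gradNormSq (u t) ≤ R) ∧
        (∀ t : ℝ, 0 ≤ t → ∀ S : Finset (d → ℤ), ∑ k ∈ S, Real.exp (2 * σ * Real.sqrt (Torus.freqNormSq k)) *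
          ‖mFourierCoeff (EuclideanSpace.complexify ∘ u t) k‖ ^ 2 ≤ C) ∧
        ((x : Lp (EuclideanSpace ℝ d) 2 (volume : Measure (UnitAddTorus d))) : UnitAddTorus d → EuclideanSpace ℝ d)
          =ᵐ[volume] u 0) :
    IsCompact K₁ := by
  refine IsSeqCompact.isCompact fun xs hxs => ?_
  choose u p hsol hmean hR hG hrep using fun n => (hK₁ (xs n)).1 (hxs n)
  have hsm : ∀ n, Torus.IsSmooth (u n 0) := fun n => (hsol n).smooth_velocity.isSmooth_slice (mem_Ici.2 le_rfl)
  -- a subsequence of the data converges in `H¹` to a smooth solenoidal mean-zero `w`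
  obtain ⟨w, ψ, hψ, hw, hwdiv, hwmean, -, hL2, hH1⟩ := Torus.exists_smooth_limit_of_gevrey_bound hσ (fun n => u n 0) hsm
    (fun n => (hsol n).divFree 0 (mem_Ici.2 le_rfl)) (fun n => hmean n 0 le_rfl) (fun n S => hG n 0 le_rfl S)
  -- the solutions converge to a global classical solution through `w` with the same bounds
  obtain ⟨v, q, hv, hv0, hvmean, hvR, hvG, -⟩ := Torus.exists_global_classicalNS_of_tendsto_of_bounds hd hν
    (U := fun n => u (ψ n)) (P := fun n => p (ψ n)) (fun n => hsol (ψ n)) (fun n => hmean (ψ n)) (fun n => hR (ψ n))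
    (fun k => Real.exp (2 * σ * Real.sqrt (Torus.freqNormSq k))) (fun n => hG (ψ n)) hw hwdiv hwmean hL2 hH1
  -- the state of `w` is in `K₁` and is the limit of the subsequence
  obtain ⟨x, hx⟩ := Torus.exists_energySpace_coe_ae_eq hw hwdiv hwmean
  refine ⟨x, (hK₁ x).2 ⟨v, q, hv, hvmean, hvR, hvG, by rw [hv0]; exact hx⟩, ψ, hψ, ?_⟩
  have hnorm : ∀ n, ‖xs (ψ n) - x‖ = Real.sqrt (∫ y, ‖u (ψ n) 0 y - w y‖ ^ 2) := fun n => by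
    rw [← Torus.energySpace_norm_sub_sq_eq (hrep (ψ n)) hx, Real.sqrt_sq (norm_nonneg _)]
  rw [tendsto_iff_norm_sub_tendsto_zero]
  have h := (Real.continuous_sqrt.tendsto 0).comp hL2
  rw [Real.sqrt_zero] at h
  refine (tendsto_congr fun n => ?_).2 h
  exact hnorm n

end TrajectorySet

end Literature.Analysis.FluidPDE

end
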